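import Summits.BirchSwinnertonDyer.BirchSwinnertonDyer.Theorems.ThetaPartnerAtTwoSignedMainConjectureCMTwoRankZeroPTDeepTransferTools
import Summits.BirchSwinnertonDyer.BirchSwinnertonDyer.Theorems.ThetaPartnerAtTwoSignedMainConjectureCMTwoRankZeroPTDeepLocalTransport
import Literature.NumberTheory.GaloisRepresentations.ContinuousShapiroLiftUnitComponents
import Literature.NumberTheory.EllipticCurves.KummerSelmerStructure
import HarnessLib

/-!
# Greenberg LNM 1716 Lemma 4.6 on `Γ`-invariants (H46), kernel road C′, brick B5 §3 (the auxiliary place `v₀`): from the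
# PRESCRIBED localisation `loc_{v₀}(Sh c) = H¹(u) z̃` (B4's output at `v₀`) to H46 clause (iii) — the local VALUE of EVERY
# conjugate of the realiser is `res z`, `z` the Kummer push of `z̃`

Cell `bsd-2adic` (run/shared/lean/pub/bsd-2adic/), seat `bsd-2adic-tower-1` GEN 34; `--supports stmt-BirchSwinnertonDyer-19271` (helper).
THEOREMS ONLY (no definition, no named fact, no instance declaration, no `sorry`); closes no item; nothing booked; BSD is not
proved by any of this. Companion of `…TorsionEulerCharH46RealiserStrict` (B5 at the strict places, at `∞` and at the good places) and of
the generic Literature brick `GaloisRepresentations/ContinuousShapiroLiftUnitComponents`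
(`map_comapSubtypeHom_conjMap_eq_resSubgroup_of_map_shapiroLift_eq`: a Shapiro lift with a prescribed UNIT restriction along
`θ : Γ_{K_v} → Γ_K` has all its conjugates restricting to the prescribed local class).

For a number field `K`, `E = W`, a prime `p`, a `ℤ_p`-extension `κ` with layers `Γ_n = κ.layerSubgroup n` and `Γ_∞ = κ.kerSubgroup`,
a finite place `v`, `M = E[p^k]` (`X = (W.torsionGaloisModule (p^k)).toTopRep`), a unit `u : M|_{Γ_{K_v}} ⟶ Maps(Γ_K ⧸ Γ_n, M)|_{Γ_{K_v}}`
(constant functions), a layer class `c ∈ H¹(Γ_n, E[p^k])` and a LOCAL class `z̃ ∈ H¹(K_v, E[p^k])`: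

* `localResOver_conjH1_realiser_eq_resOfLe_of_localization_shapiroLift_eq` — if `loc_v (Sh c) = H¹(u) z̃` then for every `σ ∈ Γ_K`

    `loc_v^{K_∞}(conj_σ T(c)) = res_{Γ_{K_v}|_⊤ → Γ_{K_v}|_{Γ_∞}} z`,  `z := res_⊤ (κ_v z̃) ∈ H¹(Γ_{K_v}|_⊤, E(K̄_v))`,

  where `T(c) = h_n (push c) ∈ H¹(Γ_∞, E[p^∞])` is the realiser of the companion file (TP2 push spelling), `κ_v = H¹(pointsMap)` is the
  local Kummer map `H¹(K_v, E[p^k]) → H¹(K_v, E(K̄_v))` (`galoisCohomology.map (W.torsionPointsMapIntertwining (p^k) K_v) 1`) and `res_⊤` the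
  tautological restriction to `localSubgroup ⊤ K_v` (the currency of `H46`, GEN 32 `…TorsionEulerCharTMap.resOfLe_top_realizes`). This is
  LITERALLY clause (iii) of the print fact `Greenberg1999.lemma46_gammaInvariants_auxPlace_rat` for the class `z`.

Proof: `conj_σ T(c) = h_n (push (σ · c))` (`layerToInfty_conjH1`, `conjH1_push`); by the Literature brick every conjugate `σ · c` restricts
along `θ_{Γ_n} : Γ_n^{K_v} → Γ_n` to `res z̃`; both sides of the claim are then the class of ONE explicit cocycle
`x ↦ pointsMap (ζ x)` on `Γ_{K_v}|_{Γ_∞}` (`ζ` a cocycle of `z̃`), by the cocycle formulas `resH1Hom_oneCocycleClass`, `map_oneCocycleClass`,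
`resSubgroup_oneCocycleClass`, `galoisCohomology.map_one_oneCocycleClass`.

References: [GreenbergLNM1716] §4 Lemma 4.6 (p. 105), Lemma 4.7 (p. 108); [NeukirchSchmidtWingberg2008] I §5 (1.5.6)–(1.5.7), I §6 Prop. (1.6.4);
[SerreGaloisCohomology1997] I §2.4–2.5.
-/

set_option autoImplicit false
-- the Theorems namespace of this sub repeats the summit name by design (D-0017 nested layout)
set_option linter.dupNamespace false

noncomputable section

open scoped Classical NumberField

namespace Summit.BirchSwinnertonDyer.BirchSwinnertonDyer.Theorems

namespace TorsionEulerChar.H46Realiser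

open CategoryTheory Field NumberField IsDedekindDomain
  Literature.NumberTheory.GaloisRepresentations Literature.NumberTheory.GaloisRepresentations.DiscreteGaloisModule
  Literature.NumberTheory.EllipticCurves Literature.NumberTheory.EllipticCurves.GreenbergSelmer ZpExtension
open _root_.TopRep _root_.ContinuousCohomology
open SignedLowerOffTwo.PTDeep

variable {K : Type} [Field K] [NumberField K] (W : WeierstrassCurve K) (p : ℕ) [Fact p.Prime]
  (κ : ZpExtension K p) (n k : ℕ) [Fintype (absoluteGaloisGroup K ⧸ κ.layerSubgroup n)]
  {s : absoluteGaloisGroup K ⧸ κ.layerSubgroup n → absoluteGaloisGroup K}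
  (hs : ∀ x : absoluteGaloisGroup K ⧸ κ.layerSubgroup n, (s x : absoluteGaloisGroup K ⧸ κ.layerSubgroup n) = x)
  (hs1 : s ((1 : absoluteGaloisGroup K) : absoluteGaloisGroup K ⧸ κ.layerSubgroup n) = 1)

/-- **H46 clause (iii) at the auxiliary place.** Let `v` be a finite place of `K`, `θ = absGaloisRestrict K K_v : Γ_{K_v} → Γ_K`,
`u : E[p^k]|_θ ⟶ Maps(Γ_K ⧸ Γ_n, E[p^k])|_θ` a unit (`(u x)(y) = x`), `c ∈ H¹(Γ_n, E[p^k])` a layer class and `z̃ ∈ H¹(Γ_{K_v}, E[p^k]|_θ)`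
a local class with `loc_v (Sh c) = H¹(u) z̃` (the output of the levelwise Poitou–Tate call, B4, at `v = v₀`). Then for every `σ ∈ Γ_K`
the local class over `K_∞` of the conjugate `conj_σ T(c)` of the realiser `T(c) = h_n (push c) ∈ H¹(Γ_∞, E[p^∞])` is the restriction
to `Γ_{K_v}|_{Γ_∞} ≤ Γ_{K_v}|_⊤` of the class `z := res_⊤ (κ_v z̃) ∈ H¹(Γ_{K_v}|_⊤, E(K̄_v))`, `κ_v` the local Kummer map
`H¹(K_v, E[p^k]) → H¹(K_v, E(K̄_v))` — clause (iii) of `Greenberg1999.lemma46_gammaInvariants_auxPlace_rat` for `z`.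
[cite: GreenbergLNM1716, §4 Lemma 4.6 (p. 105), Lemma 4.7 (p. 108)] [cite: NeukirchSchmidtWingberg2008, I §6 Prop. (1.6.4)] -/
theorem localResOver_conjH1_realiser_eq_resOfLe_of_localization_shapiroLift_eq (v : HeightOneSpectrum (𝓞 K))
    (uθ : TopRep.res (absGaloisRestrict K (v.adicCompletion K) : absoluteGaloisGroup (v.adicCompletion K) →* absoluteGaloisGroup K)
        (W.torsionGaloisModule ((p : ℤ) ^ k)).toTopRep ⟶
      TopRep.res (absGaloisRestrict K (v.adicCompletion K) : absoluteGaloisGroup (v.adicCompletion K) →* absoluteGaloisGroup K)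
        (coindFin (W.torsionGaloisModule ((p : ℤ) ^ k)).toTopRep (κ.layerSubgroup n)))
    (hu : ∀ (x : W.geomTorsion ((p : ℤ) ^ k)) (y : absoluteGaloisGroup K ⧸ κ.layerSubgroup n),
      (uθ.hom x : absoluteGaloisGroup K ⧸ κ.layerSubgroup n → W.geomTorsion ((p : ℤ) ^ k)) y = x)
    (c : W.torsionH1Over ((p : ℤ) ^ k) (κ.layerSubgroup n))
    (zt : continuousCohomology 1
      (TopRep.res (absGaloisRestrict K (v.adicCompletion K) : absoluteGaloisGroup (v.adicCompletion K) →* absoluteGaloisGroup K)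
        (W.torsionGaloisModule ((p : ℤ) ^ k)).toTopRep))
    (h0 : galoisCohomology.localization ((W.torsionGaloisModule ((p : ℤ) ^ k)).coind (κ.layerSubgroup n) (κ.isOpen_layerSubgroup n))
        (Sum.inr v) 1
        (shapiroLift (W.torsionGaloisModule ((p : ℤ) ^ k)).toTopRep (κ.layerSubgroup n) (κ.isOpen_layerSubgroup n) hs hs1 c) =
      cohomologyMap uθ 1 zt)
    (σ : absoluteGaloisGroup K) :
    W.localResOver p κ.kerSubgroup (v.adicCompletion K) (W.conjH1 p κ.kerSubgroup σ (W.layerToInfty κ n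
        (resH1Hom (N := W.geomPrimaryTorsion p) (subgroupInclusion (le_refl (κ.layerSubgroup n)))
          (AddSubgroup.inclusion (AcSigned.geomTorsion_zpow_le_geomPrimaryTorsion W p k)) (fun _ _ ↦ rfl) c))) =
      Literature.NumberTheory.EllipticCurves.resOfLe (localPoints W (v.adicCompletion K))
        (Subgroup.comap_mono le_top :
          localSubgroup κ.kerSubgroup (v.adicCompletion K) ≤
            localSubgroup (⊤ : Subgroup (absoluteGaloisGroup K)) (v.adicCompletion K))
        (resH1Hom (Literature.NumberTheory.EllipticCurves.subgroupIncl
            (localSubgroup (⊤ : Subgroup (absoluteGaloisGroup K)) (v.adicCompletion K)))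
          (AddMonoidHom.id (localPoints W (v.adicCompletion K))) (fun _ _ ↦ rfl)
          (galoisCohomology.map (W.torsionPointsMapIntertwining ((p : ℤ) ^ k) (v.adicCompletion K)) 1 zt)) := by
  -- Step 0: `conj_σ T(c) = h_n (push (σ · c))`
  rw [← W.layerToInfty_conjH1 κ, conjH1_push]
  -- Step 1 (the Literature brick): `θ_N^*(σ · c) = res_{θ⁻¹N} zt`, `θ = absGaloisRestrict K K_v`, `N = Γ_n`
  have hx : ContinuousCohomology.map (comapSubtypeHom (κ.layerSubgroup n) (absGaloisRestrict K (v.adicCompletion K)))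
      (comapCoeffHom (W.torsionGaloisModule ((p : ℤ) ^ k)).toTopRep (κ.layerSubgroup n) (absGaloisRestrict K (v.adicCompletion K)))
      1 (conjMap (W.torsionGaloisModule ((p : ℤ) ^ k)).toTopRep (κ.layerSubgroup n) σ 1 c) =
      resSubgroup (TopRep.res (absGaloisRestrict K (v.adicCompletion K) :
          absoluteGaloisGroup (v.adicCompletion K) →* absoluteGaloisGroup K) (W.torsionGaloisModule ((p : ℤ) ^ k)).toTopRep)
        ((κ.layerSubgroup n).comap (absGaloisRestrict K (v.adicCompletion K) :
          absoluteGaloisGroup (v.adicCompletion K) →* absoluteGaloisGroup K)) 1 zt :=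
    map_comapSubtypeHom_conjMap_eq_resSubgroup_of_map_shapiroLift_eq (W.torsionGaloisModule ((p : ℤ) ^ k)).toTopRep
      (κ.layerSubgroup n) (absGaloisRestrict K (v.adicCompletion K)) (κ.isOpen_layerSubgroup n) hs hs1 uθ hu
      (TopRep.ofHom ⟨ContinuousLinearMap.id ℤ _, fun _ => rfl⟩) (fun _ => rfl) c zt h0 σ
  -- Step 2: cocycle representatives `φ` of `σ · c` and `ζ` of `zt`
  obtain ⟨φ, hφ⟩ := oneCocycleClass_surjective (discreteTopRep (κ.layerSubgroup n) (W.geomTorsion ((p : ℤ) ^ k)))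
    (conjH1 (κ.layerSubgroup n) (W.geomTorsion ((p : ℤ) ^ k)) σ c)
  obtain ⟨ζ, rfl⟩ := oneCocycleClass_surjective (TopRep.res (absGaloisRestrict K (v.adicCompletion K) :
    absoluteGaloisGroup (v.adicCompletion K) →* absoluteGaloisGroup K) (W.torsionGaloisModule ((p : ℤ) ^ k)).toTopRep) zt
  rw [← hφ]
  have hx1 : ContinuousCohomology.map (comapSubtypeHom (κ.layerSubgroup n) (absGaloisRestrict K (v.adicCompletion K)))
      (comapCoeffHom (W.torsionGaloisModule ((p : ℤ) ^ k)).toTopRep (κ.layerSubgroup n) (absGaloisRestrict K (v.adicCompletion K)))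
      1 (oneCocycleClass (discreteTopRep (κ.layerSubgroup n) (W.geomTorsion ((p : ℤ) ^ k))) φ) =
      resSubgroup (TopRep.res (absGaloisRestrict K (v.adicCompletion K) :
          absoluteGaloisGroup (v.adicCompletion K) →* absoluteGaloisGroup K) (W.torsionGaloisModule ((p : ℤ) ^ k)).toTopRep)
        ((κ.layerSubgroup n).comap (absGaloisRestrict K (v.adicCompletion K) :
          absoluteGaloisGroup (v.adicCompletion K) →* absoluteGaloisGroup K)) 1
        (oneCocycleClass (TopRep.res (absGaloisRestrict K (v.adicCompletion K) :
          absoluteGaloisGroup (v.adicCompletion K) →* absoluteGaloisGroup K) (W.torsionGaloisModule ((p : ℤ) ^ k)).toTopRep) ζ) := by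
    rw [hφ]; exact hx
  have hA1 : ContinuousCohomology.map (comapSubtypeHom (κ.layerSubgroup n) (absGaloisRestrict K (v.adicCompletion K)))
      (comapCoeffHom (W.torsionGaloisModule ((p : ℤ) ^ k)).toTopRep (κ.layerSubgroup n) (absGaloisRestrict K (v.adicCompletion K)))
      1 (oneCocycleClass (discreteTopRep (κ.layerSubgroup n) (W.geomTorsion ((p : ℤ) ^ k))) φ) = _ :=
    map_oneCocycleClass _ (comapSubtypeHom (κ.layerSubgroup n) (absGaloisRestrict K (v.adicCompletion K)))
      (comapCoeffHom (W.torsionGaloisModule ((p : ℤ) ^ k)).toTopRep (κ.layerSubgroup n) (absGaloisRestrict K (v.adicCompletion K))) φ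
  rw [hA1, resSubgroup_oneCocycleClass] at hx1
  -- Step 3: push both sides along the compatible pair `(Γ_{K_v}|_{Γ_∞} ↪ θ⁻¹N, pointsMap : E[p^k] → E(K̄_v))`
  have hG : localSubgroup κ.kerSubgroup (v.adicCompletion K) ≤
      (κ.layerSubgroup n).comap (absGaloisRestrict K (v.adicCompletion K) :
        absoluteGaloisGroup (v.adicCompletion K) →* absoluteGaloisGroup K) := by
    intro x hx'
    rw [mem_localSubgroup_iff] at hx'
    exact Subgroup.mem_comap.mpr (κ.kerSubgroup_le_layerSubgroup n hx')
  have hGx := congrArg (fun y => ContinuousCohomology.map (subgroupInclusion hG)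
    (X := subgroupRep (TopRep.res (absGaloisRestrict K (v.adicCompletion K) :
          absoluteGaloisGroup (v.adicCompletion K) →* absoluteGaloisGroup K) (W.torsionGaloisModule ((p : ℤ) ^ k)).toTopRep)
        ((κ.layerSubgroup n).comap (absGaloisRestrict K (v.adicCompletion K) :
          absoluteGaloisGroup (v.adicCompletion K) →* absoluteGaloisGroup K)))
    (Y := discreteTopRep (localSubgroup κ.kerSubgroup (v.adicCompletion K)) (localPoints W (v.adicCompletion K)))
    (TopRep.ofHom
      { toContinuousLinearMap :=
          ⟨((pointsMap W (v.adicCompletion K)).comp (W.geomTorsion ((p : ℤ) ^ k)).subtype).toIntLinearMap,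
            continuous_of_discreteTopology⟩
        isIntertwining' := fun x => by
          ext P
          change pointsMap W (v.adicCompletion K)
              (((absGaloisRestrict K (v.adicCompletion K) (x : absoluteGaloisGroup (v.adicCompletion K))) • P :
                W.geomTorsion ((p : ℤ) ^ k)) : W.geomPoints) =
            (x : absoluteGaloisGroup (v.adicCompletion K)) • pointsMap W (v.adicCompletion K) (P : W.geomPoints)
          rw [Literature.NumberTheory.EllipticCurves.AddSubgroup.torsionBy.coe_smul]
          exact pointsMap_smul W (v.adicCompletion K) (x : absoluteGaloisGroup (v.adicCompletion K)) (P : W.geomPoints) })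
    1 y) hx1
  rw [map_oneCocycleClass, map_oneCocycleClass] at hGx
  -- Step 4: both sides of the claim are classes of explicit cocycles
  have hB1 : galoisCohomology.map (W.torsionPointsMapIntertwining ((p : ℤ) ^ k) (v.adicCompletion K)) 1
      (oneCocycleClass (TopRep.res (absGaloisRestrict K (v.adicCompletion K) :
        absoluteGaloisGroup (v.adicCompletion K) →* absoluteGaloisGroup K) (W.torsionGaloisModule ((p : ℤ) ^ k)).toTopRep) ζ) =
      oneCocycleClass (discreteTopRep (absoluteGaloisGroup (v.adicCompletion K)) (localPoints W (v.adicCompletion K)))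
        (contOneCocycles.pullback (ContinuousMonoidHom.id (absoluteGaloisGroup (v.adicCompletion K)))
          (X := DiscreteGaloisModule.toTopRep (GaloisRep.restrictField (v.adicCompletion K) (W.torsionGaloisModule ((p : ℤ) ^ k))))
          (Y := discreteTopRep (absoluteGaloisGroup (v.adicCompletion K)) (localPoints W (v.adicCompletion K)))
          (TopRep.ofHom ⟨(W.torsionPointsMapIntertwining ((p : ℤ) ^ k) (v.adicCompletion K)).toContinuousLinearMap,
            (W.torsionPointsMapIntertwining ((p : ℤ) ^ k) (v.adicCompletion K)).isIntertwining'⟩) ζ) :=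
    W.map_torsionPointsMapIntertwining_oneCocycleClass ((p : ℤ) ^ k) (v.adicCompletion K) ζ
  rw [hB1]
  simp only [WeierstrassCurve.localResOver, WeierstrassCurve.localResOverOfEmb, WeierstrassCurve.layerToInfty,
    WeierstrassCurve.resOfLe, Literature.NumberTheory.EllipticCurves.resOfLe]
  simp only [resH1Hom_oneCocycleClass]
  refine (resH1Hom_oneCocycleClass _ _ _ _).trans ?_
  refine Eq.trans ?_ (resH1Hom_oneCocycleClass _ _ _ _).symm
  exact hGx

end TorsionEulerChar.H46Realiser

end Summit.BirchSwinnertonDyer.BirchSwinnertonDyer.Theorems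

end
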